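import Summits.NavierStokesRegularity.NavierStokesRegularity.Theorems.ExtremiserTransiencePerFlowScaleLockOfEnstrophyRate
import HarnessLib

/-!
# Route `ExtremiserTransience`, LINE g4-α «per-flow-tangent» (ns-idea-5 g4): the LOWER half of the scale lock is UNCONDITIONAL

`--supports stmt-NavierStokesRegularity-26568` (`TangentExtremalExtraction`; skeleton v3 stub (E) / theorem `scaleLock_of_enstrophyRate_stub`).

Write `λ² := Z/P` (`Z = ‖ω‖₂²`, `P = ‖∇ω‖₂²`; the dissipation length of the vorticity). For the flows of the crux
`NearExtremalTransiencePerFlow` (classical Leray–Hopf, rapidly decaying datum, eventual Type-I rate `√(T−t)‖u‖ ≤ C√ν`,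
no smooth extension past `T`) that violate the per-flow conclusion, this file proves WITHOUT the open stub (E):

* `lowerLock_at_nearEfficient_times` — there is `c > 0` such that for every level `0 < m < κ⋆` and onset `t₁ < T` the
  late times that are strictly `m`-efficient AND satisfy `c·m²·ν(T−t)·P ≤ Z` — i.e. `λ² ≥ c m² ν(T−t)`, the dissipation
  length is AT LEAST PARABOLIC — form a non-null set.  Mechanism: the landed cap `m²M²P ≤ ‖∇u‖²_∞ Z`
  (`palinstrophy_cap_at_nearEfficient_times`), the gradient Type-I rate `(T−t)‖∇u‖ ≤ C₁` (`gradTypeIRate_of_typeIRate`)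
  and Leray's lower rate `c₀√ν ≤ √(T−t)·M` (`lerayLowerRate_of_not_extends`); `c = c₀²/C₁²`.

So of the two-sided lock only the UPPER side `λ² ≲ ν(T−t)` is open, and by `scaleLock_of_rates` it is equivalent (at
efficient times, given the landed floor) to (E) "enstrophy at Leray's minimal rate".  Energy-class information gives only
`λ² ≤ 2E₀/Z ≲ √(T−t)` (interpolation `‖∇u‖₂² ≤ ‖u‖₂‖∇ω‖₂` + Leray's `H¹` rate): the missing half-power is the supercritical
gap of this line.  HONEST FRAMING: nothing about Navier–Stokes regularity or blow-up is proved; items 26567/26568 stay open.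
References: Leray 1934 §19; KNSS 2009 Prop. 4.1/(4.10); RRS 2016 (6.7). [folklore]
-/

noncomputable section
open Set Filter Topology MeasureTheory
open scoped InnerProductSpace RealInnerProductSpace ENNReal NNReal ContDiff
open Literature.Analysis.FluidPDE

namespace Summit.NavierStokesRegularity.NavierStokesRegularity.Theorems.DepletionLadder.PerFlow
set_option linter.dupNamespace false
set_option linter.style.longLine false

/-- **Lower lock, unconditional: the dissipation length is at least parabolic at near-efficient late times.**
See the module docstring. [folklore] -/
theorem lowerLock_at_nearEfficient_times {C ν T : ℝ} (hC : 0 < C) (hν : 0 < ν) (hT : 0 < T)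
    {u : ℝ → EuclideanSpace ℝ (Fin 3) → EuclideanSpace ℝ (Fin 3)} {p : ℝ → EuclideanSpace ℝ (Fin 3) → ℝ}
    (hsol : IsClassicalNSSolutionOn (Ico 0 T) ν 0 u p) (hLH : IsLerayHopfOn T ν 0 (u 0) u)
    (hdec : HasRapidSpatialDecay (u 0))
    (hrate : ∀ᶠ t in 𝓝[<] T, ∀ x, Real.sqrt (T - t) * ‖u t x‖ ≤ C * Real.sqrt ν)
    (hext : ¬ HasSmoothExtensionPast ν 0 u T)
    (hnot : ¬ (∃ θ : ℝ, 0 ≤ θ ∧ θ < 1 ∧ ∀ κ : ℝ, (∀ (v : EuclideanSpace ℝ (Fin 3) → EuclideanSpace ℝ (Fin 3)) (M B : ℝ), ContDiff ℝ (⊤ : ℕ∞) v → Literature.Analysis.FluidPDE.VectorCalculus.IsDivFree v → (∀ x, ‖v x‖ ≤ M) → (∀ x, ‖fderiv ℝ v x‖ ≤ B) → (∫⁻ x, ‖iteratedFDeriv ℝ 0 v x‖ₑ ^ 2 < ⊤) → (∫⁻ x, ‖iteratedFDeriv ℝ 1 v x‖ₑ ^ 2 < ⊤) → (∫⁻ x,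 ‖iteratedFDeriv ℝ 2 v x‖ₑ ^ 2 < ⊤) → |∫ x, ⟪Literature.Analysis.FluidPDE.curl v x, fderiv ℝ v x (Literature.Analysis.FluidPDE.curl v x)⟫_ℝ| ≤ κ * M * Real.sqrt (∫ x, ‖Literature.Analysis.FluidPDE.curl v x‖ ^ 2) * Real.sqrt (∫ x, Literature.Analysis.FluidPDE.frobeniusNormSq (fderiv ℝ (Literature.Analysis.FluidPDE.curl v) x))) → ∃ t₁ ∈ Set.Ico 0 T, ∃ (k : ℝ → ℝ) (B : ℝ), Measurable k ∧ (∀ τ, 0 ≤ k τ ∧ k τ ≤ 1) ∧ (∀ t ∈ Set.Ico t₁ T, ∀ M : ℝ, (∀ x, ‖u t x‖ ≤ M) → |∫ x, ⟪Literature.Analysis.FluidPDE.curl (u t) x, fderiv ℝ (u t) x (Literature.Analysis.FluidPDE.curl (u t) x)⟫_ℝ| ≤ k t * M * Real.sqrt (∫ x, ‖Literature.Analysis.FluidPDE.curl (u t) x‖ ^ 2) * Real.sqrt (∫ x, Literature.Analysis.FluidPDE.frobeniusNormSq (fderiv ℝ (Literature.Analysis.FluidPDE.curl (u t)) x))) ∧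 (∀ t ∈ Set.Ico t₁ T, ∫ τ in t₁..t, k τ ^ 2 / (T - τ) ≤ (θ * κ) ^ 2 * Real.log ((T - t₁) / (T - t)) + B))) :
    ∃ c : ℝ, 0 < c ∧ ∀ m : ℝ, 0 < m → m < sInf {κ : ℝ | (∀ (v : EuclideanSpace ℝ (Fin 3) → EuclideanSpace ℝ (Fin 3)) (M B : ℝ), ContDiff ℝ (⊤ : ℕ∞) v → Literature.Analysis.FluidPDE.VectorCalculus.IsDivFree v → (∀ x, ‖v x‖ ≤ M) → (∀ x, ‖fderiv ℝ v x‖ ≤ B) → (∫⁻ x, ‖iteratedFDeriv ℝ 0 v x‖ₑ ^ 2 < ⊤) → (∫⁻ x, ‖iteratedFDeriv ℝ 1 v x‖ₑ ^ 2 < ⊤) → (∫⁻ x, ‖iteratedFDeriv ℝ 2 v x‖ₑ ^ 2 < ⊤) → |∫ x, ⟪Literature.Analysis.FluidPDE.curl v x, fderiv ℝ v x (Literature.Analysis.FluidPDE.curl v x)⟫_ℝ| ≤ κ * M * Real.sqrt (∫ x, ‖Literature.Analysis.FluidPDE.curl v x‖ ^ 2) * Real.sqrt (∫ x, Literature.Analysis.FluidPDE.frobeniusNormSq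 (fderiv ℝ (Literature.Analysis.FluidPDE.curl v) x)))} → ∀ t₁ ∈ Set.Ico 0 T,
      volume {t : ℝ | t ∈ Set.Ico t₁ T ∧ (∃ M : ℝ, (∀ x, ‖u t x‖ ≤ M) ∧ m * M * Real.sqrt (∫ x, ‖Literature.Analysis.FluidPDE.curl (u t) x‖ ^ 2) * Real.sqrt (∫ x, Literature.Analysis.FluidPDE.frobeniusNormSq (fderiv ℝ (Literature.Analysis.FluidPDE.curl (u t)) x)) < |∫ x, ⟪Literature.Analysis.FluidPDE.curl (u t) x, fderiv ℝ (u t) x (Literature.Analysis.FluidPDE.curl (u t) x)⟫_ℝ|) ∧ c * m ^ 2 * (ν * (T - t)) * (∫ x, Literature.Analysis.FluidPDE.frobeniusNormSq (fderiv ℝ (Literature.Analysis.FluidPDE.curl (u t)) x)) ≤ (∫ x, ‖Literature.Analysis.FluidPDE.curl (u t) x‖ ^ 2)} ≠ 0 := by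
  obtain ⟨C₁, hC₁, hgrad⟩ := gradTypeIRate_of_typeIRate hC hν hT hsol hLH hdec hrate
  obtain ⟨c₀, hc₀, hleray⟩ := lerayLowerRate_of_not_extends hν hT hsol hLH hdec hext
  obtain ⟨a, haT, hsub⟩ := mem_nhdsLT_iff_exists_Ioo_subset.1 hgrad
  have haT' : a < T := haT
  refine ⟨c₀ ^ 2 / C₁ ^ 2, by positivity, ?_⟩
  intro m hm hmlt t₁ ht₁ hnull
  set t₁' : ℝ := max t₁ ((a + T) / 2) with ht₁'
  have ht₁'T : t₁' < T := max_lt ht₁.2 (by linarith [haT'])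
  have ht₁'0 : 0 ≤ t₁' := ht₁.1.trans (le_max_left _ _)
  have ht₁t₁' : t₁ ≤ t₁' := le_max_left _ _
  have hat₁' : a < t₁' := lt_of_lt_of_le (by linarith [haT'] : a < (a + T) / 2) (le_max_right _ _)
  refine palinstrophy_cap_at_nearEfficient_times hν hT hsol hLH hdec hnot m hm hmlt t₁' ⟨ht₁'0, ht₁'T⟩
    (measure_mono_null ?_ hnull)
  rintro t ⟨ht, M, hM, heff, hcap⟩
  have htT : t ∈ Set.Ico 0 T := ⟨ht₁'0.trans ht.1, ht.2⟩
  have hTt : 0 < T - t := sub_pos.2 ht.2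
  have hsT : 0 < Real.sqrt (T - t) := Real.sqrt_pos.2 hTt
  set Zt : ℝ := (∫ x, ‖Literature.Analysis.FluidPDE.curl (u t) x‖ ^ 2) with hZt
  set Pt : ℝ := (∫ x, Literature.Analysis.FluidPDE.frobeniusNormSq (fderiv ℝ (Literature.Analysis.FluidPDE.curl (u t)) x)) with hPt
  have hP0 : 0 ≤ Pt := integral_nonneg fun x => frobeniusNormSq_nonneg _
  -- gradient bound at `t` and the cap with `B = C₁/(T−t)`
  have hBt : ∀ x, ‖fderiv ℝ (u t) x‖ ≤ C₁ / (T - t) := fun x => by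
    rw [le_div_iff₀ hTt, mul_comm]; exact hsub ⟨hat₁'.trans_le ht.1, ht.2⟩ x
  have hcap' : m ^ 2 * M ^ 2 * Pt ≤ (C₁ / (T - t)) ^ 2 * Zt := hcap _ hBt
  -- Leray: `c₀² ν ≤ (T−t) M²`
  obtain ⟨x₀, hx₀⟩ := hleray t htT
  have hLM : c₀ * Real.sqrt ν ≤ Real.sqrt (T - t) * M :=
    hx₀.trans (mul_le_mul_of_nonneg_left (hM x₀) hsT.le)
  have hLM2 : c₀ ^ 2 * ν ≤ (T - t) * M ^ 2 := by
    have h := pow_le_pow_left₀ (by positivity) hLM 2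
    rw [mul_pow, mul_pow, Real.sq_sqrt hν.le, Real.sq_sqrt hTt.le] at h
    exact h
  refine ⟨⟨ht₁t₁'.trans ht.1, ht.2⟩, ⟨M, hM, heff⟩, ?_⟩
  -- `c₀² m² ν (T−t) P ≤ m² M² (T−t)² P ≤ C₁² Z`
  have key : c₀ ^ 2 * m ^ 2 * (ν * (T - t)) * Pt ≤ C₁ ^ 2 * Zt := by
    calc c₀ ^ 2 * m ^ 2 * (ν * (T - t)) * Pt = m ^ 2 * (c₀ ^ 2 * ν) * (T - t) * Pt := by ring
      _ ≤ m ^ 2 * ((T - t) * M ^ 2) * (T - t) * Pt := by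
          apply mul_le_mul_of_nonneg_right _ hP0
          apply mul_le_mul_of_nonneg_right _ hTt.le
          exact mul_le_mul_of_nonneg_left hLM2 (by positivity)
      _ = (m ^ 2 * M ^ 2 * Pt) * (T - t) ^ 2 := by ring
      _ ≤ ((C₁ / (T - t)) ^ 2 * Zt) * (T - t) ^ 2 := mul_le_mul_of_nonneg_right hcap' (by positivity)
      _ = C₁ ^ 2 * Zt := by field_simp
  have hC₁2 : 0 < C₁ ^ 2 := by positivity
  calc c₀ ^ 2 / C₁ ^ 2 * m ^ 2 * (ν * (T - t)) * Pt = (c₀ ^ 2 * m ^ 2 * (ν * (T - t)) * Pt) / C₁ ^ 2 := by ring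
    _ ≤ (C₁ ^ 2 * Zt) / C₁ ^ 2 := div_le_div_of_nonneg_right key hC₁2.le
    _ = Zt := by field_simp

end Summit.NavierStokesRegularity.NavierStokesRegularity.Theorems.DepletionLadder.PerFlow

end
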